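import Summits.HubbardSuperconductivity.HubbardSuperconductivity.Theorems.AnisotropyChordTransferFibre3Lam2Small

/-!
# Route `AnisotropyChord` / H0 rotor rung: the LOGARITHMIC a-priori bound on the ground two-magnon eigenvalue, IIb — the sharp ring count `2π/n − 2/n²`

Sharpening of `…Fibre3GresZeroLower` (`Σ_{0<|m|∞≤N} 1/|m|² ≥ 4H_N`, ring count `8n·(1/2n²)`): the ring `|m|∞ = n` actually
carries `Σ ≈ 2π/n` (Riemann sum of `∫ du/(1+u²)`), which is the exact leading coefficient of `G̃₀(0) = (1/2π) ln L + O(1)`.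
* `arctan_sub_le`: `arctan((t+1)/M) − arctan(t/M) ≤ M/(M² + t²)` for `t ≥ 0` (mean value theorem, `arctan' = 1/(1+x²)` decreasing);
* `sum_range_inv_sq_ge`: `Σ_{i<M} 1/(M² + i²) ≥ π/(4M)` (telescoping);
* `ring_sum_ge`: `Σ_{|m|∞ = n+1} 1/|m|² ≥ 2π/(n+1) − 2/(n+1)²` (eight disjoint half-sides `ringPt`);
* `puncturedBox_two_sum`: `Σ_{0<|m|∞≤2} 1/|m|² = 91/10`; ★ `box_sum_ge_sharp`: `Σ_{0<|m|∞≤N} 1/|m|² ≥ 2πH_N − 3π + 81/10 + 2/N` (`N ≥ 2`);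
* ★★ `Gres_zero_zero_ge_sharp`: **`G̃₀(0) ≥ (2πH_N − 3π + 81/10 + 2/N)/(4π²)`**, `N = (L−1)/2`, `L ≥ 5`; hence
  `etaEff_le_sharp_harmonic`: `η_eff ≤ π²/(2πH_N − 3π + 81/10 + 2/N)` for the ground profile (`0 ≤ Δ`), i.e. the a-priori
  Level-2 range `ν = η_eff/π² ≤ 1/(2πH_N − 3π + 8.1 + 2/N)` (`≈ .0509` at `L = 32`, `.0305` at `L = 256`; the true `G̃₀(0)` gives
  `.0422`, `.0272`).
Prover seat `hubbard-h0-rotor-p1` g24; helper for stmt-HubbardSuperconductivity-19089 (`--supports`).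
-/

set_option linter.dupNamespace false
set_option autoImplicit false

noncomputable section

open scoped BigOperators
open Complex

namespace Summit.HubbardSuperconductivity.HubbardSuperconductivity.Theorems.AnisotropyChord.Transfer.Fibre3

variable (L : ℕ) [NeZero L]

/-! ## One ring is a Riemann sum of `∫ du/(1+u²)` -/

omit [NeZero L] in
/-- mean value bound: `arctan((t+1)/M) − arctan(t/M) ≤ M/(M² + t²)` for `M > 0`, `t ≥ 0`. [folklore] -/
theorem arctan_sub_le {M t : ℝ} (hM : 0 < M) (ht : 0 ≤ t) :
    Real.arctan ((t + 1) / M) - Real.arctan (t / M) ≤ M / (M ^ 2 + t ^ 2) := by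
  have hab : t / M < (t + 1) / M := by
    apply div_lt_div_of_pos_right _ hM; linarith
  obtain ⟨c, hc, hderiv⟩ := exists_hasDerivAt_eq_slope Real.arctan (fun x => 1 / (1 + x ^ 2)) hab
    Real.continuous_arctan.continuousOn (fun x _ => Real.hasDerivAt_arctan x)
  have hba : (t + 1) / M - t / M = 1 / M := by rw [← sub_div]; ring_nf
  rw [hba] at hderiv
  have hc0 : t / M ≤ c := hc.1.le
  have htM : 0 ≤ t / M := by positivity
  have hcpos : 0 ≤ c := le_trans htM hc0
  -- `1/(1+c²) ≤ 1/(1 + (t/M)²) = M²/(M² + t²)`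
  have h1 : 1 / (1 + c ^ 2) ≤ 1 / (1 + (t / M) ^ 2) := by
    apply one_div_le_one_div_of_le (by positivity)
    nlinarith [mul_nonneg htM hcpos]
  have h2 : 1 / (1 + (t / M) ^ 2) = M ^ 2 / (M ^ 2 + t ^ 2) := by
    field_simp
  have hM' : (1 / M) ≠ 0 := by positivity
  rw [eq_div_iff hM'] at hderiv
  rw [← hderiv]
  calc 1 / (1 + c ^ 2) * (1 / M) ≤ (M ^ 2 / (M ^ 2 + t ^ 2)) * (1 / M) := by
        rw [← h2]; exact mul_le_mul_of_nonneg_right h1 (by positivity)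
    _ = M / (M ^ 2 + t ^ 2) := by field_simp

omit [NeZero L] in
/-- ★ `Σ_{i<M} 1/(M² + i²) ≥ π/(4M)` for `M ≥ 1` (telescoping the mean value bound from `arctan 0 = 0` to `arctan 1 = π/4`). [folklore] -/
theorem sum_range_inv_sq_ge (M : ℕ) (hM : 1 ≤ M) :
    Real.pi / (4 * M) ≤ ∑ i ∈ Finset.range M, 1 / ((M : ℝ) ^ 2 + (i : ℝ) ^ 2) := by
  have hMpos : (0 : ℝ) < M := by exact_mod_cast (show 0 < M by omega)
  have htel : ∑ i ∈ Finset.range M, (Real.arctan (((i : ℝ) + 1) / M) - Real.arctan ((i : ℝ) / M))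
      = Real.pi / 4 := by
    have h := Finset.sum_range_sub (fun i : ℕ => Real.arctan ((i : ℝ) / M)) M
    simp only [Nat.cast_add, Nat.cast_one] at h
    rw [h, Nat.cast_zero, zero_div, Real.arctan_zero, sub_zero, div_self hMpos.ne', Real.arctan_one]
  have hle : ∑ i ∈ Finset.range M, (Real.arctan (((i : ℝ) + 1) / M) - Real.arctan ((i : ℝ) / M))
      ≤ ∑ i ∈ Finset.range M, (M : ℝ) / ((M : ℝ) ^ 2 + (i : ℝ) ^ 2) :=
    Finset.sum_le_sum fun i _ => arctan_sub_le hMpos (Nat.cast_nonneg i)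
  rw [htel] at hle
  rw [div_le_iff₀ (by positivity)]
  calc Real.pi = Real.pi / 4 * 4 := by ring
    _ ≤ (M : ℝ) * (∑ i ∈ Finset.range M, 1 / ((M : ℝ) ^ 2 + (i : ℝ) ^ 2)) * 4 := by
        apply mul_le_mul_of_nonneg_right _ (by norm_num)
        calc Real.pi / 4 ≤ ∑ i ∈ Finset.range M, (M : ℝ) / ((M : ℝ) ^ 2 + (i : ℝ) ^ 2) := hle
          _ = (M : ℝ) * ∑ i ∈ Finset.range M, 1 / ((M : ℝ) ^ 2 + (i : ℝ) ^ 2) := by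
              rw [Finset.mul_sum]; refine Finset.sum_congr rfl fun i _ => ?_; field_simp
    _ = (∑ i ∈ Finset.range M, 1 / ((M : ℝ) ^ 2 + (i : ℝ) ^ 2)) * (4 * M) := by ring

/-! ## The ring `|m|∞ = n+1` as eight disjoint half-sides -/

omit [NeZero L] in
/-- eight half-sides of the ring `|m|∞ = n+1`, each indexed by `i ∈ {0,…,n}`. [folklore] -/
def ringPt (n : ℕ) : Fin 8 × ℕ → ℤ × ℤ
  | (0, i) => ((n : ℤ) + 1, -(i : ℤ))
  | (1, i) => ((n : ℤ) + 1, (i : ℤ) + 1)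
  | (2, i) => (-((n : ℤ) + 1), (i : ℤ))
  | (3, i) => (-((n : ℤ) + 1), -((i : ℤ) + 1))
  | (4, i) => ((i : ℤ), (n : ℤ) + 1)
  | (5, i) => (-((i : ℤ) + 1), (n : ℤ) + 1)
  | (6, i) => (-(i : ℤ), -((n : ℤ) + 1))
  | (7, i) => ((i : ℤ) + 1, -((n : ℤ) + 1))

open RateLemma in
omit [NeZero L] in
/-- the half-side points lie on the ring `puncturedBox (n+1) ∖ puncturedBox n`. [folklore] -/
theorem ringPt_mem (n : ℕ) (p : Fin 8 × ℕ) (hp : p.2 ≤ n) :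
    ringPt n p ∈ puncturedBox (n + 1) \ puncturedBox n := by
  obtain ⟨k, i⟩ := p
  simp only at hp
  rw [Finset.mem_sdiff, mem_puncturedBox, mem_puncturedBox]
  push_cast
  fin_cases k <;> simp only [ringPt, ne_eq, Prod.mk.injEq, not_and, and_imp] <;> omega

omit [NeZero L] in
/-- the eight half-sides are pairwise disjoint. [folklore] -/
theorem ringPt_injOn (n : ℕ) :
    Set.InjOn (ringPt n) (((Finset.univ : Finset (Fin 8)) ×ˢ Finset.range (n + 1) : Finset (Fin 8 × ℕ)) : Set _) := by
  intro p hp q hq h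
  obtain ⟨k, i⟩ := p
  obtain ⟨k', i'⟩ := q
  rw [Finset.mem_coe, Finset.mem_product] at hp hq
  have hi : i < n + 1 := Finset.mem_range.mp hp.2
  have hi' : i' < n + 1 := Finset.mem_range.mp hq.2
  fin_cases k <;> fin_cases k' <;>
    simp only [ringPt, Prod.mk.injEq, true_and, and_true] at h ⊢ <;> omega

omit [NeZero L] in
/-- the eight values on one rung of the half-sides: four times `1/(M² + i²)` and four times `1/(M² + (i+1)²)`, `M = n+1`. [folklore] -/
theorem sum_fin8_ringPt (n i : ℕ) :
    ∑ k : Fin 8, (1 : ℝ) / ((((ringPt n (k, i)).1 ^ 2 + (ringPt n (k, i)).2 ^ 2 : ℤ)) : ℝ)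
      = 4 * (1 / (((n : ℝ) + 1) ^ 2 + (i : ℝ) ^ 2)) + 4 * (1 / (((n : ℝ) + 1) ^ 2 + ((i : ℝ) + 1) ^ 2)) := by
  simp only [Fin.sum_univ_eight, ringPt]
  push_cast
  ring

open RateLemma in
omit [NeZero L] in
/-- ★ **the ring count from below:** `Σ_{|m|∞ = n+1} 1/|m|² ≥ 2π/(n+1) − 2/(n+1)²`. [folklore] -/
theorem ring_sum_ge (n : ℕ) :
    2 * Real.pi / ((n : ℝ) + 1) - 2 / ((n : ℝ) + 1) ^ 2
      ≤ ∑ m ∈ puncturedBox (n + 1) \ puncturedBox n, 1 / (((m.1 ^ 2 + m.2 ^ 2 : ℤ)) : ℝ) := by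
  have hMpos : (0 : ℝ) < (n : ℝ) + 1 := by positivity
  -- the sum over the image of the eight half-sides
  have himg : ∑ p ∈ (Finset.univ : Finset (Fin 8)) ×ˢ Finset.range (n + 1),
        (1 : ℝ) / ((((ringPt n p).1 ^ 2 + (ringPt n p).2 ^ 2 : ℤ)) : ℝ)
      = ∑ m ∈ ((Finset.univ : Finset (Fin 8)) ×ˢ Finset.range (n + 1)).image (ringPt n),
          1 / (((m.1 ^ 2 + m.2 ^ 2 : ℤ)) : ℝ) := by
    rw [Finset.sum_image (ringPt_injOn n)]
  have hsub : ((Finset.univ : Finset (Fin 8)) ×ˢ Finset.range (n + 1)).image (ringPt n)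
      ⊆ puncturedBox (n + 1) \ puncturedBox n := by
    intro m hm
    rw [Finset.mem_image] at hm
    obtain ⟨p, hp, rfl⟩ := hm
    have : p.2 ≤ n := by
      rw [Finset.mem_product, Finset.mem_range] at hp; omega
    exact ringPt_mem n p this
  have hnonneg : ∀ m ∈ puncturedBox (n + 1) \ puncturedBox n,
      m ∉ ((Finset.univ : Finset (Fin 8)) ×ˢ Finset.range (n + 1)).image (ringPt n) →
      (0 : ℝ) ≤ 1 / (((m.1 ^ 2 + m.2 ^ 2 : ℤ)) : ℝ) := by
    intro m _ _; positivity
  have hge := Finset.sum_le_sum_of_subset_of_nonneg hsub hnonneg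
  rw [← himg, Finset.sum_product_right] at hge
  simp only [sum_fin8_ringPt] at hge
  rw [Finset.sum_add_distrib, ← Finset.mul_sum, ← Finset.mul_sum] at hge
  -- the two inner sums
  have hA := sum_range_inv_sq_ge (n + 1) (by omega)
  push_cast at hA
  have hB : ∑ i ∈ Finset.range (n + 1), (1 : ℝ) / (((n : ℝ) + 1) ^ 2 + ((i : ℝ) + 1) ^ 2)
      = (∑ i ∈ Finset.range (n + 1), (1 : ℝ) / (((n : ℝ) + 1) ^ 2 + (i : ℝ) ^ 2))
        - 1 / ((n : ℝ) + 1) ^ 2 + 1 / (((n : ℝ) + 1) ^ 2 + ((n : ℝ) + 1) ^ 2) := by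
    have h1 := Finset.sum_range_succ' (fun i : ℕ => (1 : ℝ) / (((n : ℝ) + 1) ^ 2 + (i : ℝ) ^ 2)) (n + 1)
    have h2 := Finset.sum_range_succ (fun i : ℕ => (1 : ℝ) / (((n : ℝ) + 1) ^ 2 + (i : ℝ) ^ 2)) (n + 1)
    simp only [Nat.cast_add, Nat.cast_one, Nat.cast_zero] at h1 h2
    rw [h2] at h1
    have e0 : ((n : ℝ) + 1) ^ 2 + (0 : ℝ) ^ 2 = ((n : ℝ) + 1) ^ 2 := by ring
    rw [e0] at h1
    linarith
  have hlast : 1 / (((n : ℝ) + 1) ^ 2 + ((n : ℝ) + 1) ^ 2) = 1 / (2 * ((n : ℝ) + 1) ^ 2) := by ring_nf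
  rw [hB, hlast] at hge
  have e : 2 * Real.pi / ((n : ℝ) + 1) - 2 / ((n : ℝ) + 1) ^ 2
      = 4 * (Real.pi / (4 * ((n : ℝ) + 1))) + 4 * (Real.pi / (4 * ((n : ℝ) + 1)) - 1 / ((n : ℝ) + 1) ^ 2
          + 1 / (2 * ((n : ℝ) + 1) ^ 2)) := by
    field_simp; ring
  rw [e]
  nlinarith

/-! ## The box sum with the sharp rings -/

open RateLemma in
omit [NeZero L] in
/-- the first two rings exactly: `Σ_{0<|m|∞≤2} 1/|m|² = 6 + 31/10 = 91/10`. [folklore] -/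
theorem puncturedBox_two_sum :
    ∑ m ∈ puncturedBox 2, 1 / (((m.1 ^ 2 + m.2 ^ 2 : ℤ)) : ℝ) = 91 / 10 := by
  have h : puncturedBox 2 =
      {((-2 : ℤ), (-2 : ℤ)), (-2, -1), (-2, 0), (-2, 1), (-2, 2), (-1, -2), (-1, -1), (-1, 0), (-1, 1), (-1, 2),
        (0, -2), (0, -1), (0, 1), (0, 2), (1, -2), (1, -1), (1, 0), (1, 1), (1, 2), (2, -2), (2, -1), (2, 0),
        (2, 1), (2, 2)} := by
    decide
  rw [h]
  rw [Finset.sum_insert (by decide), Finset.sum_insert (by decide), Finset.sum_insert (by decide),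
    Finset.sum_insert (by decide), Finset.sum_insert (by decide), Finset.sum_insert (by decide),
    Finset.sum_insert (by decide), Finset.sum_insert (by decide), Finset.sum_insert (by decide),
    Finset.sum_insert (by decide), Finset.sum_insert (by decide), Finset.sum_insert (by decide),
    Finset.sum_insert (by decide), Finset.sum_insert (by decide), Finset.sum_insert (by decide),
    Finset.sum_insert (by decide), Finset.sum_insert (by decide), Finset.sum_insert (by decide),
    Finset.sum_insert (by decide), Finset.sum_insert (by decide), Finset.sum_insert (by decide),
    Finset.sum_insert (by decide), Finset.sum_insert (by decide), Finset.sum_singleton]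
  norm_num

open RateLemma in
omit [NeZero L] in
/-- ★ **the sharp box count:** `Σ_{0<|m|∞≤N} 1/|m|² ≥ 2πH_N − 3π + 81/10 + 2/N` for `N ≥ 2`
(rings `n ≥ 3` by `ring_sum_ge` with `2/n² ≤ 2/(n−1) − 2/n`, rings `1, 2` exactly). [folklore] -/
theorem box_sum_ge_sharp (N : ℕ) (hN : 2 ≤ N) :
    2 * Real.pi * (harmonic N : ℝ) - 3 * Real.pi + 81 / 10 + 2 / (N : ℝ)
      ≤ ∑ m ∈ puncturedBox N, 1 / (((m.1 ^ 2 + m.2 ^ 2 : ℤ)) : ℝ) := by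
  induction N with
  | zero => omega
  | succ n ih =>
    rcases Nat.lt_or_ge n 2 with hn | hn
    · -- `N = 2`
      have : n = 1 := by omega
      subst this
      rw [show (1 + 1 : ℕ) = 2 from rfl, puncturedBox_two_sum, harmonic_two]
      push_cast
      nlinarith [Real.pi_pos]
    · have ih' := ih hn
      rw [← Finset.sum_sdiff (puncturedBox_mono n), harmonic_succ, Rat.cast_add, Rat.cast_inv, Rat.cast_natCast,
        Nat.cast_succ]
      have hring := ring_sum_ge n
      have hnpos : (0 : ℝ) < n := by exact_mod_cast (show 0 < n by omega)
      have hn1 : (0 : ℝ) < (n : ℝ) + 1 := by positivity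
      -- `2/(n+1) − 2/n ≤ −2/(n+1)²`
      have hkey : 2 / ((n : ℝ) + 1) - 2 / (n : ℝ) ≤ -(2 / ((n : ℝ) + 1) ^ 2) := by
        have e1 : 2 / (n : ℝ) - 2 / ((n : ℝ) + 1) = 2 / ((n : ℝ) * ((n : ℝ) + 1)) := by
          field_simp; ring
        have e2 : 2 / ((n : ℝ) + 1) ^ 2 ≤ 2 / ((n : ℝ) * ((n : ℝ) + 1)) :=
          div_le_div_of_nonneg_left (by norm_num) (by positivity) (by nlinarith)
        linarith
      have e : 2 * Real.pi * ((harmonic n : ℝ) + ((n : ℝ) + 1)⁻¹) = 2 * Real.pi * (harmonic n : ℝ)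
          + 2 * Real.pi / ((n : ℝ) + 1) := by rw [mul_add, div_eq_mul_inv]
      rw [e]
      linarith

/-! ## The sharpened bound on `G̃₀(0)` and on `η_eff` -/

/-- ★★ **`G̃₀(0) ≥ (2πH_N − 3π + 81/10 + 2/N)/(4π²)`**, `N = (L−1)/2`, `L ≥ 5`. [folklore] -/
theorem Gres_zero_zero_ge_sharp (hL : 5 ≤ L) :
    (2 * Real.pi * (harmonic ((L - 1) / 2) : ℝ) - 3 * Real.pi + 81 / 10 + 2 / ((((L - 1) / 2 : ℕ)) : ℝ))
        / (4 * Real.pi ^ 2) ≤ Gres L 0 0 := by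
  have hN : 2 * ((L - 1) / 2) + 1 ≤ L := by omega
  have h1 := Gres_zero_zero_ge_box L (by omega) ((L - 1) / 2) hN
  have h2 := box_sum_ge_sharp ((L - 1) / 2) (by omega)
  have hπ : 0 < Real.pi ^ 2 := by positivity
  calc _ = (1 / (4 * Real.pi ^ 2)) * (2 * Real.pi * (harmonic ((L - 1) / 2) : ℝ) - 3 * Real.pi + 81 / 10
            + 2 / ((((L - 1) / 2 : ℕ)) : ℝ)) := by field_simp
    _ ≤ (1 / (4 * Real.pi ^ 2)) * ∑ m ∈ RateLemma.puncturedBox ((L - 1) / 2), 1 / (((m.1 ^ 2 + m.2 ^ 2 : ℤ)) : ℝ) :=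
        mul_le_mul_of_nonneg_left h2 (by positivity)
    _ ≤ Gres L 0 0 := h1

omit [NeZero L] in
/-- the sharp box constant is positive for `N ≥ 2` (`2πH_N ≥ 3π`). [folklore] -/
theorem box_const_pos (N : ℕ) (hN : 2 ≤ N) :
    0 < 2 * Real.pi * (harmonic N : ℝ) - 3 * Real.pi + 81 / 10 + 2 / (N : ℝ) := by
  have h := Literature.NumberTheory.LFunctions.LagariasNumerical.harmonic_mono hN
  rw [harmonic_two] at h
  have h' : ((3 / 2 : ℚ) : ℝ) ≤ ((harmonic N : ℚ) : ℝ) := by exact_mod_cast h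
  push_cast at h'
  have hNpos : (0 : ℝ) < N := by exact_mod_cast (show 0 < N by omega)
  have : 0 < 2 / (N : ℝ) := by positivity
  nlinarith [Real.pi_pos]

/-- ★★ **`η_eff ≤ π²/(2πH_N − 3π + 81/10 + 2/N)`** for the ground two-magnon profile (`L ≥ 5`, `0 ≤ Δ`, `N = (L−1)/2`):
the sharpened a-priori Level-2 range `ν = η_eff/π² ≤ 1/(2πH_N − 3π + 8.1 + 2/N)`. [folklore] -/
theorem etaEff_le_sharp_harmonic (hL : 5 ≤ L) {Δ lam2 : ℝ} (hΔ : 0 ≤ Δ) {f : Tor L → ℝ}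
    (hf : IsGroundTwoMagnon L Δ lam2 f) :
    etaEff L lam2 ≤ Real.pi ^ 2 / (2 * Real.pi * (harmonic ((L - 1) / 2) : ℝ) - 3 * Real.pi + 81 / 10
      + 2 / ((((L - 1) / 2 : ℕ)) : ℝ)) := by
  have h1 := etaEff_le_inv_Gres L (by omega) hΔ hf
  have h2 := Gres_zero_zero_ge_sharp L hL
  have hc := box_const_pos ((L - 1) / 2) (by omega)
  have hπ : 0 < Real.pi ^ 2 := by positivity
  have hG := Gres_zero_zero_pos L (by omega)
  calc etaEff L lam2 ≤ 1 / (4 * Gres L 0 0) := h1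
    _ ≤ 1 / (4 * ((2 * Real.pi * (harmonic ((L - 1) / 2) : ℝ) - 3 * Real.pi + 81 / 10
          + 2 / ((((L - 1) / 2 : ℕ)) : ℝ)) / (4 * Real.pi ^ 2))) :=
        one_div_le_one_div_of_le (by positivity) (by linarith)
    _ = _ := by field_simp

end Summit.HubbardSuperconductivity.HubbardSuperconductivity.Theorems.AnisotropyChord.Transfer.Fibre3

end
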